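import Summits.AtomisticToContinuum.BoseEinsteinCondensation.Theses.BECDyadicChaining
import Summits.AtomisticToContinuum.BoseEinsteinCondensation.Theorems.BECDyadicChainingDyadicCoherenceDefectFreeDirichletEnergyMode
import Literature.MathematicalPhysics.QuantumManyBody.BoseGasCatStates
import HarnessLib

/-!
# Route `BECDyadicChaining` — crux `DyadicCoherenceDefect`, stub `stub_freeDirichletEnergy` (U)

The sharp upper bound on the free `N`-boson Dirichlet ground-state energy of the box
`Λ_L = (0,L)³` (units `ħ = 2m = 1`): `E₀(v = 0, N, L) ≤ 3Nπ²/L²` for `N ≥ 1`, `L > 0`.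

Proof. The exact minimiser `∏_{i,k} sin(π x_{ik}/L)` is not an admissible `TrialState` (it is not
`C¹` across the faces once extended by `0`), so we use `C¹` approximants. One dimension
(`…FreeDirichletEnergyMode`, `exists_profile`): for every `δ > 0` a `C¹` profile `G` vanishing
with `G'` off `(0, L)`, `∫₀ᴸ G² = 1`, `∫₀ᴸ G'² ≤ (π/L)² + δ`. Three dimensions (`mode_facts`):
the tensor mode `u(x) = ∏ₖ G(xₖ)` has `∫|u|² = 1` and `∫|∇u|² = 3 ∫G'² (∫G²)² ≤ 3((π/L)² + δ)`
(product rule and Fubini over the three coordinates) and vanishes off `Λ_L`. `N` bodies: the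
power state `u^{⊗N}` (`powFun`, `rawEnergy_zero_powFun`, `lintegral_powFun_sq` of
`BoseGasCatStates`) is an admissible trial state of energy `N ∫|∇u|² ≤ 3N((π/L)² + δ)`; let
`δ → 0`. No new definitions.
-/

noncomputable section

namespace Summit.AtomisticToContinuum.BoseEinsteinCondensation.Cruxes.DyadicCoherenceDefect.Birth

open Filter MeasureTheory
open scoped ENNReal NNReal BigOperators
open Literature.MathematicalPhysics.QuantumManyBody.BoseGas
open Summit.AtomisticToContinuum.BoseEinsteinCondensation.Theses

namespace FreeDirichletEnergy

open Set intervalIntegral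

/-! ### Three dimensions: the tensor mode `u(x) = ∏ₖ G(xₖ)` -/

/-- Fubini over the three coordinates of `ℝ³` for nonnegative integrable continuous factors:
`∫ ∏ⱼ fⱼ(xⱼ) dx = ∏ⱼ ∫ fⱼ` (in `ℝ≥0∞`, through `EuclideanSpace ℝ (Fin 3) ≃ (Fin 3 → ℝ)`).
[folklore] -/
theorem lintegral_prod_coord (f : Fin 3 → ℝ → ℝ) (hc : ∀ j, Continuous (f j))
    (hi : ∀ j, Integrable (f j)) (h0 : ∀ j t, 0 ≤ f j t) :
    ∫⁻ y : Space, ENNReal.ofReal (∏ j, f j (y j)) = ENNReal.ofReal (∏ j, ∫ t, f j t) := by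
  have hm : Measurable fun z : Fin 3 → ℝ => ENNReal.ofReal (∏ j, f j (z j)) :=
    ENNReal.measurable_ofReal.comp
      (Finset.measurable_prod _ fun j _ => (hc j).measurable.comp (measurable_pi_apply j))
  calc ∫⁻ y : Space, ENNReal.ofReal (∏ j, f j (y j))
      = ∫⁻ z : Fin 3 → ℝ, ENNReal.ofReal (∏ j, f j (z j)) :=
        (PiLp.volume_preserving_ofLp (Fin 3)).lintegral_comp hm
    _ = ENNReal.ofReal (∫ z : Fin 3 → ℝ, ∏ j, f j (z j)) :=
        (ofReal_integral_eq_lintegral_ofReal (Integrable.fintype_prod hi)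
          (ae_of_all _ fun z => Finset.prod_nonneg fun j _ => h0 j (z j))).symm
    _ = ENNReal.ofReal (∏ j, ∫ t, f j t) := by rw [integral_fintype_prod_volume_eq_prod]

/-- Partial derivatives of a tensor product on `ℝ³`:
`∂ₖ ∏ⱼ G(xⱼ) = G'(xₖ) ∏_{j ≠ k} G(xⱼ)` for `G ∈ C¹`. [folklore] -/
theorem fderiv_prod_coord {G : ℝ → ℝ} (hG : ContDiff ℝ 1 G) (y : Space) (k : Fin 3) :
    fderiv ℝ (fun x : Space => ∏ j, G (x j)) y (EuclideanSpace.single k (1 : ℝ)) =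
      deriv G (y k) * ∏ j ∈ Finset.univ.erase k, G (y j) := by
  set P : Fin 3 → (Space →L[ℝ] ℝ) := fun j => EuclideanSpace.proj j with hP
  have hfac : ∀ j, HasFDerivAt (fun x : Space => G (x j)) (deriv G (y j) • P j) y := fun j =>
    ((hG.differentiable one_ne_zero) (y j)).hasDerivAt.comp_hasFDerivAt y (P j).hasFDerivAt
  have hprod := HasFDerivAt.finsetProd (u := Finset.univ) fun j _ => hfac j
  rw [hprod.fderiv]
  have hPk : ∀ j, P j (EuclideanSpace.single k (1 : ℝ)) = if j = k then 1 else 0 := fun j => by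
    simp [hP]
  simp only [_root_.sum_apply, _root_.smul_apply, hPk, smul_eq_mul,
    mul_ite, mul_one, mul_zero, Finset.sum_ite_eq', Finset.mem_univ, if_true]
  ring

/-- `(H(xₖ) ∏_{j ≠ k} G(xⱼ))² = ∏ⱼ Fⱼ(xⱼ)` with `Fₖ = H²`, `Fⱼ = G²` (`j ≠ k`). [folklore] -/
theorem sq_mul_prod_erase (G H : ℝ → ℝ) (y : Space) (k : Fin 3) :
    (H (y k) * ∏ j ∈ Finset.univ.erase k, G (y j)) ^ 2 =
      ∏ j, (if j = k then H (y j) ^ 2 else G (y j) ^ 2) := by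
  rw [mul_pow, ← Finset.prod_pow, ← Finset.mul_prod_erase Finset.univ _ (Finset.mem_univ k),
    if_pos rfl]
  congr 1
  exact Finset.prod_congr rfl fun j hj => by rw [if_neg (Finset.ne_of_mem_erase hj)]

/-- The kinetic density of a real one-body mode `g` (cast to `ℂ`) seen as a one-particle wave
function is `|∇g|²(x₀)`. [folklore] -/
theorem kineticDensity_oneFun_ofReal {g3 : Space → ℝ} (hg : Differentiable ℝ g3) (Y : Config 1) :
    kineticDensity (oneFun fun x => ((g3 x : ℝ) : ℂ)) Y =
      ∑ k : Fin 3, (‖fderiv ℝ g3 (Y 0) (EuclideanSpace.single k (1 : ℝ))‖₊ : ℝ≥0∞) ^ 2 := by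
  have h : HasFDerivAt (oneFun fun x => ((g3 x : ℝ) : ℂ))
      (Complex.ofRealCLM.comp ((fderiv ℝ g3 (Y 0)).comp
        (ContinuousLinearMap.proj (R := ℝ) (φ := fun _ : Fin 1 => Space) 0))) Y := by
    have h1 := (hg (Y 0)).hasFDerivAt.comp Y
      (ContinuousLinearMap.proj (R := ℝ) (φ := fun _ : Fin 1 => Space) 0).hasFDerivAt
    exact Complex.ofRealCLM.hasFDerivAt.comp Y h1
  unfold kineticDensity
  rw [h.fderiv, Fin.sum_univ_one]
  refine Finset.sum_congr rfl fun k _ => ?_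
  simp [Complex.nnnorm_real]

/-- **The tensor mode.** For `G ∈ C¹(ℝ)` vanishing with `G'` off `(0, L)`, `∫₀ᴸ G² = 1`,
`∫₀ᴸ G'² ≤ A`: the mode `u(x) = ∏ₖ G(xₖ)` is `C¹` as a one-particle wave function, normalised,
vanishes off the box `Λ_L`, and has free one-body energy `∫|∇u|² = 3 ∫G'² (∫G²)² ≤ 3A`
(product rule and Fubini over the coordinates). [folklore] -/
theorem mode_facts {L A : ℝ} (hL : 0 < L) {G : ℝ → ℝ} (hG : ContDiff ℝ 1 G)
    (h0 : ∀ t, t ∉ Ioo 0 L → G t = 0) (h0' : ∀ t, t ∉ Ioo 0 L → deriv G t = 0)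
    (h1 : ∫ t in 0..L, G t ^ 2 = 1) (h2 : ∫ t in 0..L, deriv G t ^ 2 ≤ A)
    (g3 : Space → ℝ) (hg3 : g3 = fun x => ∏ j, G (x j)) (u : Space → ℂ)
    (hu : u = fun x => ((g3 x : ℝ) : ℂ)) :
    ContDiff ℝ 1 (oneFun u) ∧ (∫⁻ Y, (‖oneFun u Y‖₊ : ℝ≥0∞) ^ 2 = 1) ∧
    rawEnergy 0 (oneFun u) ≤ ENNReal.ofReal (3 * A) ∧ ∀ x : Space, x ∉ box L → u x = 0 := by
  -- whole-line one-dimensional facts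
  have hGc : Continuous G := hG.continuous
  have hG'c : Continuous (deriv G) := hG.continuous_deriv le_rfl
  have hIcc : ∀ t, t ∉ Icc (0 : ℝ) L → t ∉ Ioo (0 : ℝ) L := fun t ht h => ht (Ioo_subset_Icc_self h)
  have hIoc : ∀ t, t ∉ Ioc (0 : ℝ) L → t ∉ Ioo (0 : ℝ) L := fun t ht h => ht (Ioo_subset_Ioc_self h)
  have hK : IsCompact (Icc (0 : ℝ) L) := isCompact_Icc
  have hGi : Integrable (fun t => G t ^ 2) :=
    (hGc.pow 2).integrable_of_hasCompactSupport
      (HasCompactSupport.intro hK fun t ht => by simp [h0 t (hIcc t ht)])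
  have hG'i : Integrable (fun t => deriv G t ^ 2) :=
    (hG'c.pow 2).integrable_of_hasCompactSupport
      (HasCompactSupport.intro hK fun t ht => by simp [h0' t (hIcc t ht)])
  have hint1 : ∫ t, G t ^ 2 = 1 := by
    calc ∫ t, G t ^ 2 = ∫ t in Ioc 0 L, G t ^ 2 :=
          (setIntegral_eq_integral_of_forall_compl_eq_zero fun t ht => by
            simp [h0 t (hIoc t ht)]).symm
      _ = ∫ t in 0..L, G t ^ 2 := (intervalIntegral.integral_of_le hL.le).symm
      _ = 1 := h1
  have hint2 : ∫ t, deriv G t ^ 2 ≤ A := by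
    calc ∫ t, deriv G t ^ 2 = ∫ t in Ioc 0 L, deriv G t ^ 2 :=
          (setIntegral_eq_integral_of_forall_compl_eq_zero fun t ht => by
            simp [h0' t (hIoc t ht)]).symm
      _ = ∫ t in 0..L, deriv G t ^ 2 := (intervalIntegral.integral_of_le hL.le).symm
      _ ≤ A := h2
  -- the real tensor mode
  have hg3C : ContDiff ℝ 1 g3 := by
    rw [hg3]
    exact contDiff_prod fun j _ => hG.comp (EuclideanSpace.proj (𝕜 := ℝ) j).contDiff
  have huC : ContDiff ℝ 1 u := by rw [hu]; exact Complex.ofRealCLM.contDiff.comp hg3C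
  refine ⟨huC.comp (contDiff_apply ℝ Space 0), ?_, ?_, ?_⟩
  · -- normalisation
    unfold oneFun
    rw [lintegral_funUnique_comp (fun x => (‖u x‖₊ : ℝ≥0∞) ^ 2)]
    have hpt : ∀ x : Space, (‖u x‖₊ : ℝ≥0∞) ^ 2 = ENNReal.ofReal (∏ j, G (x j) ^ 2) := fun x => by
      rw [hu, hg3]
      simp only [ennnorm_real_sq, Finset.prod_pow]
    simp_rw [hpt]
    calc ∫⁻ x : Space, ENNReal.ofReal (∏ j, G (x j) ^ 2)
        = ENNReal.ofReal (∏ _j : Fin 3, ∫ t, G t ^ 2) :=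
          lintegral_prod_coord (fun _ t => G t ^ 2) (fun _ => hGc.pow 2) (fun _ => hGi)
            fun _ t => sq_nonneg _
      _ = 1 := by simp [hint1]
  · -- kinetic energy
    unfold rawEnergy
    simp only [interaction_zeroPotential, zero_mul, add_zero]
    have hdiff : Differentiable ℝ g3 := hg3C.differentiable one_ne_zero
    have hkin : ∀ Y : Config 1, kineticDensity (oneFun u) Y =
        ∑ k : Fin 3, (‖fderiv ℝ g3 (Y 0) (EuclideanSpace.single k (1 : ℝ))‖₊ : ℝ≥0∞) ^ 2 :=
      fun Y => by rw [hu]; exact kineticDensity_oneFun_ofReal hdiff Y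
    simp_rw [hkin]
    rw [lintegral_funUnique_comp (fun y : Space =>
      ∑ k : Fin 3, (‖fderiv ℝ g3 y (EuclideanSpace.single k (1 : ℝ))‖₊ : ℝ≥0∞) ^ 2),
      lintegral_finsetSum _ fun k _ =>
        ((measurable_fderiv_apply_const ℝ g3 _).nnnorm.coe_nnreal_ennreal).pow_const 2]
    have hterm : ∀ k : Fin 3,
        ∫⁻ y : Space, (‖fderiv ℝ g3 y (EuclideanSpace.single k (1 : ℝ))‖₊ : ℝ≥0∞) ^ 2 ≤
          ENNReal.ofReal A := by
      intro k
      set F : Fin 3 → ℝ → ℝ := fun j => if j = k then fun t => deriv G t ^ 2 else fun t => G t ^ 2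
        with hF
      have hFc : ∀ j, Continuous (F j) := fun j => by
        by_cases hj : j = k <;> simp only [hF, hj, if_true, if_false] <;> fun_prop
      have hFi : ∀ j, Integrable (F j) := fun j => by
        by_cases hj : j = k <;> simp only [hF, hj, if_true, if_false]
        exacts [hG'i, hGi]
      have hF0 : ∀ j t, 0 ≤ F j t := fun j t => by
        by_cases hj : j = k <;> simp only [hF, hj, if_true, if_false] <;> positivity
      have hpt : ∀ y : Space, (‖fderiv ℝ g3 y (EuclideanSpace.single k (1 : ℝ))‖₊ : ℝ≥0∞) ^ 2 =
          ENNReal.ofReal (∏ j, F j (y j)) := fun y => by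
        rw [← Poincare.ofReal_norm_sq, Real.norm_eq_abs, sq_abs, hg3, fderiv_prod_coord hG y k,
          sq_mul_prod_erase]
        congr 1
        refine Finset.prod_congr rfl fun j _ => ?_
        by_cases hj : j = k <;> simp [hF, hj]
      have hFint : ∀ j, ∫ t, F j t = if j = k then ∫ t, deriv G t ^ 2 else 1 := fun j => by
        by_cases hj : j = k <;> simp [hF, hj, hint1]
      simp_rw [hpt]
      rw [lintegral_prod_coord F hFc hFi hF0]
      simp_rw [hFint]
      rw [Finset.prod_ite_eq']
      simp only [Finset.mem_univ, if_true]
      exact ENNReal.ofReal_le_ofReal hint2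
    calc ∑ k : Fin 3, ∫⁻ y : Space, (‖fderiv ℝ g3 y (EuclideanSpace.single k (1 : ℝ))‖₊ : ℝ≥0∞) ^ 2
        ≤ ∑ _k : Fin 3, ENNReal.ofReal A := Finset.sum_le_sum fun k _ => hterm k
      _ = ENNReal.ofReal (3 * A) := by
          rw [Finset.sum_const, Finset.card_univ, Fintype.card_fin, nsmul_eq_mul,
            ENNReal.ofReal_mul (by norm_num : (0:ℝ) ≤ 3)]
          norm_num
  · -- support
    intro x hx
    have hx' : ¬ ∀ j, x j ∈ Ioo (0 : ℝ) L := hx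
    obtain ⟨j, hj⟩ := not_forall.1 hx'
    rw [hu, hg3]
    simp only [Complex.ofReal_eq_zero]
    exact Finset.prod_eq_zero (Finset.mem_univ j) (h0 _ hj)

end FreeDirichletEnergy


open FreeDirichletEnergy in
/-- **Stub U: the free Dirichlet ground-state energy from above**, `E₀(v = 0, N, L) ≤ 3Nπ²/L²` for
`N ≥ 1`, `L > 0` (units `ħ = 2m = 1`, box `(0,L)³`): the power states `u_δ^{⊗N}` of the normalised
`C¹` tensor modes `u_δ(x) = ∏ₖ G_δ(xₖ)` (`exists_profile`, `mode_facts`) are admissible trial states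
of energy `N ∫|∇u_δ|² ≤ 3N((π/L)² + δ)` for every `δ > 0`. [cite: LSSY2005, Ch. 2 (2.3)] -/
theorem stub_freeDirichletEnergy :
    ∀ (N : ℕ) (L : ℝ), 1 ≤ N → 0 < L →
      groundStateEnergy 0 N L ≤ ENNReal.ofReal (3 * N * Real.pi ^ 2 / L ^ 2) := by
  intro N L hN hL
  refine ENNReal.le_of_forall_pos_le_add fun η hη _ => ?_
  have hN0 : (0 : ℝ) < N := by exact_mod_cast hN
  set δ : ℝ := (η : ℝ) / (3 * N) with hδ
  have hδ0 : 0 < δ := by positivity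
  obtain ⟨G, hG, h0, h0', h1, h2⟩ := exists_profile hL hδ0
  set g3 : Space → ℝ := fun x => ∏ j, G (x j) with hg3
  set u : Space → ℂ := fun x => ((g3 x : ℝ) : ℂ) with hu
  obtain ⟨huC, hnorm, hE, hbox⟩ := mode_facts hL hG h0 h0' h1 h2 g3 hg3 u hu
  let Ψ : TrialState N L :=
    { ψ := powFun u N
      contDiff := contDiff_powFun huC N
      eq_zero := fun X hX => by
        have : ∃ i, X i ∉ box L := by simpa [boxN] using hX
        obtain ⟨i, hi⟩ := this
        exact powFun_eq_zero_of_exists _ ⟨i, hbox _ hi⟩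
      symm := fun σ X => powFun_comp_perm _ σ X
      norm_eq := lintegral_powFun_sq huC hnorm N }
  calc groundStateEnergy 0 N L ≤ energy 0 Ψ := groundStateEnergy_le_energy 0 Ψ
    _ = N * rawEnergy 0 (oneFun u) := by
        rw [energy_eq_rawEnergy]; exact rawEnergy_zero_powFun huC hnorm N
    _ ≤ N * ENNReal.ofReal (3 * ((Real.pi / L) ^ 2 + δ)) := by gcongr
    _ = ENNReal.ofReal (3 * N * Real.pi ^ 2 / L ^ 2) + η := by
        rw [← ENNReal.ofReal_natCast, ← ENNReal.ofReal_mul (Nat.cast_nonneg _),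
          show (N : ℝ) * (3 * ((Real.pi / L) ^ 2 + δ)) = 3 * N * Real.pi ^ 2 / L ^ 2 + η by
            rw [hδ]; field_simp,
          ENNReal.ofReal_add (by positivity) η.coe_nonneg, ENNReal.ofReal_coe_nnreal]

end Summit.AtomisticToContinuum.BoseEinsteinCondensation.Cruxes.DyadicCoherenceDefect.Birth

end
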